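import Summits.QuantumFields.BalabanUV.Beta.RootedJetTwist
import Summits.QuantumFields.BalabanUV.Beta.RootedJetReflectionExpanded

/-!
# RootedT2JetReflection — 33I: the axis-reflection law of the second-order background response `T2At`, at jet level

b2b / pub-balaban, unit `b2b-balaban-beta-an3` gen 33 (letter supplier AN3, border chain «B», file 1 of 3), BINDER-OWNERS
row D1 / typer row HR-W-LET.  Pure algebra over any ring `𝔸` and field `𝕜`; no analysis, no measure, no new constants.

HONEST FRAMING. «discharging BetaPertH makes Bałaban's UV stability UNCONDITIONAL — a real constructive-QFT result; it is
NOT the continuum limit and NOT the Clay problem.»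
HONEST DEPENDENCY. «continuum YM on T⁴ ⇐ BetaPertH ∧ nine spine estimates (0/9 proved); BetaPertH ⇐ (D1) ∧ (D4) ∧ CAP+tail;
G-an2-4 gates asym, D1 and NE2/3/4.»  This file discharges NO binder of row D1; it is the jet-level half of the proof of
BX2's bond-level border law `hB` (`BorderLetterPacking.borderInv_of_bondLaw`).

## Content (all `[folklore]`: nested dual numbers and the rooted averaging calculus of nodes 12/12b, 33D, 33F, 33G, 33H)

Write `w = R1g α ω`, `b = R1g α B`, `c = R1g α B′` (signed pull-backs), `ρ_c = ctr d L`, `L` odd, `x′ = bref α α x`.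

* §1 `c11_conj` — the `τ₁τ₂`-component of a background conjugation `P · X · n` (`P · n = 1`, `c00 n = 1`) in `Tau 𝔸`:
  `c11 X − [n₁₀, X₀₁] − [n₀₁, X₁₀] − [n₁₁, X₀₀] + {n₁₀, n₀₁} X₀₀ − n₁₀ X₀₀ n₀₁ − n₀₁ X₀₀ n₁₀`.
* §2 `QjetLAt_reflected` — THE REFLECTED JET BY COMPONENTS: the rooted jet of the reflected chart data
  `(ω♯, E♯, Ē♯)` of 33D is `Q(w; b, c) + τ₁ Q(ad1R b) + τ₂ Q(ad1R c) + τ₁τ₂ Q(ad12R) + τ₁τ₂ ι(c10 Q♭(dR))`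
  (33G `reflPair_Ebg_Ebi` + 33H `QjetLAt_twist` + 33G `QjetLAt_omegaR`; `Q♭` = the scalar-shadow jet, ODD in the axis
  commutator `dR`, 33H `c10_QjetAt_neg`).
* §3 `T2At_sref_of_ne` — μ ≠ α: `T2At ρ_c ω B B′ μ (sref α y) = T2At ρ_c w b c μ y + CT(B,B′) + CT(B′,B)`, the CONTACT
  components `CT = c01 Q(ad1R b) + c10 Q(ad1R c) + c00 Q(ad12R)`; the twist cancels in the ordering sum (`dR_swap`).
* §4 `T2At_bref_self` — μ = α: `T2At ρ_c ω B B′ α y′ = −(T2At ρ_c w b c α y + CT + CT′ + CJ + CJ′)`, `CJ` the six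
  conjugation terms of §1 with `n = NR` = the background of the reflected fluctuation-free averaging (33D `QjetAt_bref_self`,
  `fst_PhiRAt_zero_mul_fst_PhiLAt_zero`).

33J identifies every component (`c00/c10/c01` of the jets, `c10/c01/c11` of `NR`) with node 7aρ's rooted functionals and
evaluates at single letters; 33K takes `(0,3)` entries and lands `hB` verbatim.
-/

namespace Summit.QuantumFields.BalabanUV.Beta.RootedT2JetReflection

open Literature.MathematicalPhysics.QuantumFieldTheory.Balaban1983to89
open Literature.MathematicalPhysics.QuantumFieldTheory.Balaban1983to89.Beta
open AffineAveraging (Form1)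
open AveragingContoursRooted (ctr)
open AveragingThirdJet (Tau Rho Ebg Ebi)
open AveragingThirdJet.Tau (τ₁ τ₂ τ12 ι c00 c10 c01 c11 ext4)
open AveragingMixedJetTables (PhiGAt PhiRAt QjetAt T2At)
open ResolventReflection (sref bref)
open Summit.QuantumFields.BalabanUV.Beta.RootedHolonomyReflection (R1g R1g_of_ne)
open Summit.QuantumFields.BalabanUV.Beta.RootedHolonomyReflectionHol (reflPair)
open Summit.QuantumFields.BalabanUV.Beta.RootedJetReflection (PhiLAt QjetLAt omegaR omegaR_of_ne omegaR_self QjetAt_eq_QjetLAt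
  QjetAt_sref_of_ne QjetAt_bref_self fst_PhiRAt_zero_mul_fst_PhiLAt_zero)
open Summit.QuantumFields.BalabanUV.Beta.RootedJetReflectionExpanded (dR dR_swap reflPair_Ebg_Ebi reflPair_Ebi_Ebg ad1R ad12R
  QjetLAt_omegaR)
open Summit.QuantumFields.BalabanUV.Beta.RootedJetTwist (QjetLAt_twist shadow_eq_Ebg shadow_eq_Ebi c10_QjetAt_neg)

variable {𝕜 : Type*} [Field 𝕜] {d : ℕ} {𝔸 : Type*} [Ring 𝔸] [Algebra 𝕜 𝔸]

/-! ## §1 The `τ₁τ₂`-component of a background conjugation -/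

/-- [folklore] **CONJUGATION BY AN INVERSE PAIR, `τ₁τ₂`-COMPONENT**: for `P · n = 1`, `c00 n = 1` in `Tau 𝔸`,
`c11 (P X n) = c11 X − [n₁₀, X₀₁] − [n₀₁, X₁₀] − [n₁₁, X₀₀] + {n₁₀, n₀₁} X₀₀ − n₁₀ X₀₀ n₀₁ − n₀₁ X₀₀ n₁₀`. -/
theorem c11_conj {P n : Tau 𝔸} (hPn : P * n = 1) (hn : c00 n = 1) (X : Tau 𝔸) :
    c11 (P * X * n)
      = c11 X - (c10 n * c01 X - c01 X * c10 n) - (c01 n * c10 X - c10 X * c01 n) - (c11 n * c00 X - c00 X * c11 n)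
        + (c10 n * c01 n + c01 n * c10 n) * c00 X - c10 n * c00 X * c01 n - c01 n * c00 X * c10 n := by
  have h00 : c00 P = 1 := by
    have h := congrArg c00 hPn
    simp only [AveragingThirdJet.Tau.c00_mul, hn, mul_one, AveragingThirdJet.Tau.c00_one] at h
    exact h
  have h10 : c10 P = -c10 n := by
    have h := congrArg c10 hPn
    simp only [AveragingThirdJet.Tau.c10_mul, hn, h00, mul_one, one_mul, AveragingThirdJet.Tau.c10_one] at h
    exact eq_neg_of_add_eq_zero_right h
  have h01 : c01 P = -c01 n := by
    have h := congrArg c01 hPn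
    simp only [AveragingThirdJet.Tau.c01_mul, hn, h00, mul_one, one_mul, AveragingThirdJet.Tau.c01_one] at h
    exact eq_neg_of_add_eq_zero_right h
  have h11 : c11 P = -(c11 n + -c10 n * c01 n + -c01 n * c10 n) := by
    have h := congrArg c11 hPn
    simp only [AveragingThirdJet.Tau.c11_mul, hn, h00, h10, h01, mul_one, one_mul, AveragingThirdJet.Tau.c11_one] at h
    rw [← add_assoc] at h
    exact eq_neg_of_add_eq_zero_right h
  simp only [AveragingThirdJet.Tau.c11_mul, AveragingThirdJet.Tau.c10_mul, AveragingThirdJet.Tau.c01_mul,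
    AveragingThirdJet.Tau.c00_mul, hn, h00, h10, h01, h11, mul_one, one_mul]
  noncomm_ring

/-! ## §2 The reflected jet by components -/

/-- [folklore] The scalar shadow of the reflected fluctuation letter is that of the signed pull-back (`c00 Ē = c00 E = 1`). -/
theorem c00_omegaR (α : Fin d) (ω : Form1 d (Tau 𝔸)) (B B' : Form1 d 𝔸) (κ : Fin d) (x : Fin d → ℤ) :
    c00 (omegaR α ω B B' κ x) = c00 (R1g α ω κ x) := by
  by_cases h : κ = α
  · subst h
    rw [omegaR_self]
    simp only [AveragingThirdJet.Tau.c00_mul, AveragingThirdJet.c00_Ebi, AveragingThirdJet.c00_Ebg, one_mul, mul_one]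
  · rw [omegaR_of_ne h]

variable (𝕜) in
/-- [folklore] **THE REFLECTED JET BY COMPONENTS** (any root, any bond direction): the rooted jet of 33D's reflected chart
data `(ω♯; E♯, Ē♯)` equals `Q(w; b, c) + τ₁·Q(ad1R b; b, c) + τ₂·Q(ad1R c; b, c) + τ₁τ₂·Q(ad12R; b, c) + τ₁τ₂·ι(c10 Q♭)`,
`Q♭ = QjetAt ρ (ι∘c00∘w) (dR) 0` the scalar-shadow jet of the axis twist. -/
theorem QjetLAt_reflected (ρ : Fin d → ℤ) (α : Fin d) (ω : Form1 d (Tau 𝔸)) (B B' : Form1 d 𝔸) (L : ℕ) (μ : Fin d)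
    (y : Fin d → ℤ) :
    QjetLAt 𝕜 ρ (omegaR α ω B B') (reflPair α (Ebg B B') (Ebi B B')) (reflPair α (Ebi B B') (Ebg B B')) L μ y
      = QjetAt 𝕜 ρ (R1g α ω) (R1g α B) (R1g α B') L μ y + τ₁ * QjetAt 𝕜 ρ (ad1R α ω B) (R1g α B) (R1g α B') L μ y
        + τ₂ * QjetAt 𝕜 ρ (ad1R α ω B') (R1g α B) (R1g α B') L μ y
        + τ12 * QjetAt 𝕜 ρ (ad12R α ω B B') (R1g α B) (R1g α B') L μ y
        + τ12 * ι (c10 (QjetAt 𝕜 ρ (fun κ x => ι (c00 (R1g α ω κ x))) (dR α B B') 0 L μ y)) := by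
  rw [reflPair_Ebg_Ebi, reflPair_Ebi_Ebg, QjetLAt_twist, shadow_eq_Ebg _ _ (fun κ x => by simp),
    shadow_eq_Ebi _ _ (fun κ x => by simp), QjetLAt_omegaR, ← QjetAt_eq_QjetLAt, ← QjetAt_eq_QjetLAt, ← QjetAt_eq_QjetLAt,
    ← QjetAt_eq_QjetLAt, ← QjetAt_eq_QjetLAt]
  simp only [c00_omegaR]

/-! ## §3 The μ ≠ α law -/

variable (𝕜) in
/-- [folklore] THE CONTACT COMPONENTS of the reflected jet in its `τ₁τ₂`-slot: `CT = c01 Q(ad1R b; b,c) + c10 Q(ad1R c; b,c) +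
c00 Q(ad12R(b,c); b,c)`. -/
noncomputable def CT (ρ : Fin d → ℤ) (α : Fin d) (ω : Form1 d (Tau 𝔸)) (B B' : Form1 d 𝔸) (L : ℕ) (μ : Fin d) (y : Fin d → ℤ) : 𝔸 :=
  c01 (QjetAt 𝕜 ρ (ad1R α ω B) (R1g α B) (R1g α B') L μ y) + c10 (QjetAt 𝕜 ρ (ad1R α ω B') (R1g α B) (R1g α B') L μ y)
    + c00 (QjetAt 𝕜 ρ (ad12R α ω B B') (R1g α B) (R1g α B') L μ y)

section Transverse

variable (𝕜) {L : ℕ} (hL : Odd L)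
include hL

/-- [folklore] **THE μ ≠ α LAW OF `T2At`**: `T2At ρ_c ω B B′ μ (sref α y) = T2At ρ_c w b c μ y + CT(B,B′) + CT(B′,B)` — the
axis twists of the two orderings are `c10 Q♭(±dR)` and cancel (33H `c10_QjetAt_neg`, 33G `dR_swap`). -/
theorem T2At_sref_of_ne {α μ : Fin d} (h : μ ≠ α) (ω : Form1 d (Tau 𝔸)) (B B' : Form1 d 𝔸) (y : Fin d → ℤ) :
    T2At 𝕜 (ctr d L) ω B B' L μ (sref α y)
      = T2At 𝕜 (ctr d L) (R1g α ω) (R1g α B) (R1g α B') L μ y + CT 𝕜 (ctr d L) α ω B B' L μ y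
        + CT 𝕜 (ctr d L) α ω B' B L μ y := by
  simp only [T2At, CT, QjetAt_sref_of_ne 𝕜 hL h, QjetLAt_reflected, AveragingThirdJet.Tau.c11_add,
    AveragingThirdJet.Tau.c11_τ₁_mul, AveragingThirdJet.Tau.c11_τ₂_mul, AveragingThirdJet.Tau.c11_τ12_mul,
    AveragingThirdJet.Tau.c00_ι, dR_swap α B B']
  rw [c10_QjetAt_neg]
  abel

end Transverse

/-! ## §4 The μ = α law -/

variable (𝕜) in
/-- [folklore] THE BACKGROUND OF THE REFLECTED FLUCTUATION-FREE AVERAGING: `NR = (PhiLAt ρ 0 E♯ Ē♯ L μ y).fst` (33D's `P₀`). -/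
noncomputable def NR (ρ : Fin d → ℤ) (α : Fin d) (B B' : Form1 d 𝔸) (L : ℕ) (μ : Fin d) (y : Fin d → ℤ) : Tau 𝔸 :=
  (PhiLAt 𝕜 ρ 0 (reflPair α (Ebg B B') (Ebi B B')) (reflPair α (Ebi B B') (Ebg B B')) L μ y).fst

variable (𝕜) in
/-- [folklore] THE CONJUGATION COMPONENTS: the six extra terms of §1 for `X` = the reflected jet of §2 and `n = NR`, with
`X₀₁ = c01 Q(w) + c00 Q(ad1R c)`, `X₁₀ = c10 Q(w) + c00 Q(ad1R b)`, `X₀₀ = c00 Q(w)` (backgrounds `(b, c)` throughout). -/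
noncomputable def CJ (ρ : Fin d → ℤ) (α : Fin d) (ω : Form1 d (Tau 𝔸)) (B B' : Form1 d 𝔸) (L : ℕ) (μ : Fin d) (y : Fin d → ℤ) : 𝔸 :=
  -(c10 (NR 𝕜 ρ α B B' L μ y)
        * (c01 (QjetAt 𝕜 ρ (R1g α ω) (R1g α B) (R1g α B') L μ y) + c00 (QjetAt 𝕜 ρ (ad1R α ω B') (R1g α B) (R1g α B') L μ y))
      - (c01 (QjetAt 𝕜 ρ (R1g α ω) (R1g α B) (R1g α B') L μ y) + c00 (QjetAt 𝕜 ρ (ad1R α ω B') (R1g α B) (R1g α B') L μ y))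
        * c10 (NR 𝕜 ρ α B B' L μ y))
    - (c01 (NR 𝕜 ρ α B B' L μ y)
        * (c10 (QjetAt 𝕜 ρ (R1g α ω) (R1g α B) (R1g α B') L μ y) + c00 (QjetAt 𝕜 ρ (ad1R α ω B) (R1g α B) (R1g α B') L μ y))
      - (c10 (QjetAt 𝕜 ρ (R1g α ω) (R1g α B) (R1g α B') L μ y) + c00 (QjetAt 𝕜 ρ (ad1R α ω B) (R1g α B) (R1g α B') L μ y))
        * c01 (NR 𝕜 ρ α B B' L μ y))
    - (c11 (NR 𝕜 ρ α B B' L μ y) * c00 (QjetAt 𝕜 ρ (R1g α ω) (R1g α B) (R1g α B') L μ y)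
      - c00 (QjetAt 𝕜 ρ (R1g α ω) (R1g α B) (R1g α B') L μ y) * c11 (NR 𝕜 ρ α B B' L μ y))
    + (c10 (NR 𝕜 ρ α B B' L μ y) * c01 (NR 𝕜 ρ α B B' L μ y) + c01 (NR 𝕜 ρ α B B' L μ y) * c10 (NR 𝕜 ρ α B B' L μ y))
      * c00 (QjetAt 𝕜 ρ (R1g α ω) (R1g α B) (R1g α B') L μ y)
    - c10 (NR 𝕜 ρ α B B' L μ y) * c00 (QjetAt 𝕜 ρ (R1g α ω) (R1g α B) (R1g α B') L μ y) * c01 (NR 𝕜 ρ α B B' L μ y)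
    - c01 (NR 𝕜 ρ α B B' L μ y) * c00 (QjetAt 𝕜 ρ (R1g α ω) (R1g α B) (R1g α B') L μ y) * c10 (NR 𝕜 ρ α B B' L μ y)

/-- [folklore] `c00 NR = 1` (augmentation-one letters average to an augmentation-one element). -/
theorem c00_NR (ρ : Fin d → ℤ) (α : Fin d) (B B' : Form1 d 𝔸) (L : ℕ) (μ : Fin d) (y : Fin d → ℤ) :
    c00 (NR 𝕜 ρ α B B' L μ y) = 1 := by
  have h : AveragingThirdJet.augR 𝕜
      (PhiLAt 𝕜 ρ 0 (reflPair α (Ebg B B') (Ebi B B')) (reflPair α (Ebi B B') (Ebg B B')) L μ y) = 1 :=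
    Summit.QuantumFields.BalabanUV.Beta.TruncatedNil4Calculus.aug_PhiGAt_eq_one
      (fun κ x => by simp [AveragingThirdJet.augR_apply, Summit.QuantumFields.BalabanUV.Beta.RootedJetReflection.fst_GfL,
        reflPair_Ebg_Ebi])
      (fun κ x => by simp [AveragingThirdJet.augR_apply, Summit.QuantumFields.BalabanUV.Beta.RootedJetReflection.fst_GbL,
        reflPair_Ebi_Ebg]) ρ L μ y
  simpa [NR, AveragingThirdJet.augR_apply] using h

section Longitudinal

variable (𝕜) {L : ℕ} (hL : Odd L) (h2 : (2 : 𝕜) ≠ 0)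
include hL h2

/-- [folklore] **THE μ = α LAW OF `T2At`**: on the reflected axis bond,
`T2At ρ_c ω B B′ α (bref α α y) = −(T2At ρ_c w b c α y + CT(B,B′) + CT(B′,B) + CJ(B,B′) + CJ(B′,B))`. -/
theorem T2At_bref_self (α : Fin d) (ω : Form1 d (Tau 𝔸)) (B B' : Form1 d 𝔸) (y : Fin d → ℤ) :
    T2At 𝕜 (ctr d L) ω B B' L α (bref α α y)
      = -(T2At 𝕜 (ctr d L) (R1g α ω) (R1g α B) (R1g α B') L α y + CT 𝕜 (ctr d L) α ω B B' L α y
          + CT 𝕜 (ctr d L) α ω B' B L α y + CJ 𝕜 (ctr d L) α ω B B' L α y + CJ 𝕜 (ctr d L) α ω B' B L α y) := by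
  have e1 := c11_conj (fst_PhiRAt_zero_mul_fst_PhiLAt_zero 𝕜 hL h2 α B B' y) (c00_NR (𝕜 := 𝕜) (ctr d L) α B B' L α y)
    (QjetLAt 𝕜 (ctr d L) (omegaR α ω B B') (reflPair α (Ebg B B') (Ebi B B')) (reflPair α (Ebi B B') (Ebg B B')) L α y)
  have e2 := c11_conj (fst_PhiRAt_zero_mul_fst_PhiLAt_zero 𝕜 hL h2 α B' B y) (c00_NR (𝕜 := 𝕜) (ctr d L) α B' B L α y)
    (QjetLAt 𝕜 (ctr d L) (omegaR α ω B' B) (reflPair α (Ebg B' B) (Ebi B' B)) (reflPair α (Ebi B' B) (Ebg B' B)) L α y)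
  rw [T2At, QjetAt_bref_self 𝕜 hL h2, QjetAt_bref_self 𝕜 hL h2, AveragingThirdJet.Tau.c11_neg, AveragingThirdJet.Tau.c11_neg,
    e1, e2]
  simp only [QjetLAt_reflected, CT, CJ, NR, T2At, AveragingThirdJet.Tau.c11_add, AveragingThirdJet.Tau.c01_add,
    AveragingThirdJet.Tau.c10_add, AveragingThirdJet.Tau.c00_add, AveragingThirdJet.Tau.c11_τ₁_mul,
    AveragingThirdJet.Tau.c11_τ₂_mul, AveragingThirdJet.Tau.c11_τ12_mul, AveragingThirdJet.Tau.c01_τ₁_mul,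
    AveragingThirdJet.Tau.c01_τ₂_mul, AveragingThirdJet.Tau.c01_τ12_mul, AveragingThirdJet.Tau.c10_τ₁_mul,
    AveragingThirdJet.Tau.c10_τ₂_mul, AveragingThirdJet.Tau.c10_τ12_mul, AveragingThirdJet.Tau.c00_τ₁_mul,
    AveragingThirdJet.Tau.c00_τ₂_mul, AveragingThirdJet.Tau.c00_τ12_mul, AveragingThirdJet.Tau.c00_ι, add_zero,
    dR_swap α B B']
  rw [c10_QjetAt_neg]
  abel

end Longitudinal

end Summit.QuantumFields.BalabanUV.Beta.RootedT2JetReflection
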